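import Literature.AnabelianGeometry.EtaleTheta.Discharge.Sec2Cor29OfSettingEndKnit
import Literature.AnabelianGeometry.EtaleTheta.Discharge.Sec2SplittingOfSection
import HarnessLib

/-!
# [EtTh] §2 at the §1 model, knit onto the cusp laws: the assembled cover `TemperedCoverData` and Cor. 2.9
# with the cusp binders {`hIx`, `sect x`, «unique cusp», compact `D_x`} replaced by ONE `CuspLaws` (proof-only)

S. Mochizuki, *The étale theta function and its Frobenioid-theoretic manifestations*, Publ. RIMS **45**
(2009) [EtTh], §2: Def. 2.1 p. 35 («the unique cusp of `X^log`», «`D_x → Π^Θ_X` … maps `I_x` isomorphically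
onto `Δ_Θ`»), Prop. 2.2 (ii) p. 37, Def. 2.3 p. 38, Cor. 2.9 p. 43 [cite: MochizukiEtTh2009, Cor 2.9 p.43].

Cell abc-iut, layer L2, seat abc-iut-L2-t7 (gen 4) — the CONSUMER side of the 13:00Z census filing
`ThetaSetting.CuspLaws` (`SettingBridgeCuspLaws`, items C16 / C9 / C3).  PROOF-ONLY (0 definitions), over
abc-iut-L2-d3's W3-L2-02 chain BY NAME (`Sec2SplittingOfSection`: `exists_temperedCoverData_of_section`;
`Sec2Cor29Model`: `temperedCoverData_cor29_card'`; the END KNIT `Sec2Cor29OfSettingEndKnit`: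
`temperedCoverData_hC2'`, `temperedCoverData_natCard_cuspOrbits` — which already takes compact `D_x` from the
bundle via `OncePuncturedData.isCompact_decomp`; nothing restated):

* `piCDataOf_hIx_of_cuspLaws`, `piCData_hIx_of_cuspLaws` — the binder `hIx` of `PiCData.coverDataAx` at the
  model's input bundles `e.piCDataOf ιC hιC` / `e.piCData`, from `CuspLaws` (+ the bundle `op`, odd `l`);
* **`exists_temperedCoverData_of_cuspLaws`** / `nonempty_temperedCoverData_of_cuspLaws` — abc-iut-L2-t2's
  `ThetaCovers.TemperedCoverData l` is INHABITED over the §1 model given {`op`, `CuspLaws`, `hιell` (P-C4),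
  L02 `KerToZIsCompactlyGenerated`} — the section quadruple `(s, hs, hsa, hsc)` and `hIx` are no longer binders;
* **`temperedCoverData_cor29_card_of_cuspLaws`** — [EtTh] Cor. 2.9 (all six members) for the assembled cover
  modulo {slimness of `Π^tp_C`, Prop. 2.6 (F-0610), [SemiAnbd] Thm. 6.5 (ii) (F-1658) and (iii) (F-1674)} BY NAME
  and `CuspLaws` — «unique cusp» and compact `D_x` are no longer binders; `temperedCoverData_hC2_of_cuspLaws` —
  the cusp-stabiliser clause `hC2` likewise;
* **`temperedCoverData_natCard_cuspOrbits_of_cuspLaws`** — the END KNIT's print-shaped Cor. 2.9 («Suppose that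
  `K` contains a primitive `l`-th root of unity …») with its origin clause «unique cusp» supplied by `CuspLaws`;
  **`exists_temperedCoverData_natCard_cuspOrbits_of_cuspLaws`** — the same END TO END: from {`op`, `CuspLaws`,
  `hιell`, L02} a cover `T` realising the model's cover-data axioms is PRODUCED (splitting from the section of
  C9, normalities from L02) whose six orbit counts are `(l+1)/2` modulo {slimness of `Π^tp_X`, `T.Prop26`,
  F-1658, F-1674} and the cyclotome datum `μ_l ⊆ K` + `CyclotomeMod 1 l` — no cusp binder left.

HONEST FRAMING: implications for data so parametrised; nothing asserts that a `MuTwoSetting`, a `CLevelData` or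
the cusp laws hold for any instance (they FAIL at every cusped model in the tree, `SettingModelCuspLawsCensus`,
`SettingModel2CommutatorCuspLaws`); [EtTh]/[SemiAnbd] are refereed inputs; no side is taken on [IUTchIII]
Cor. 3.12; typed ≠ proved.
-/

namespace Literature.AnabelianGeometry.EtaleTheta

open Literature.AnabelianGeometry.SemiGraphs ThetaCovers
open Literature.AlgebraicGeometry.Frobenioids (IsSlimGroup)
open _root_.Topology

namespace MuTwoSetting.CLevelData

variable {p : ℕ} [Fact p.Prime] {M : MuTwoSetting p}
variable {PC : Type} [Group PC] [TopologicalSpace PC] [IsTopologicalGroup PC] [T2Space PC]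

/-! ### The `hIx` binder at the model's input bundles -/

/-- The binder `hIx` of `coverDataAx` for the input bundle `e.piCDataOf ιC hιC` (any injective profinite
completion `ιC` of `Π^tp_C`), from the cusp laws. [cite: MochizukiEtTh2009, Def 2.1 p.35] -/
theorem piCDataOf_hIx_of_cuspLaws (e : M.CLevelData) (ιC : M.GtpC →ₜ* PC) (hιC : IsProfiniteCompletion ιC)
    (op : M.toThetaSetting.OncePuncturedData) (hL : M.toThetaSetting.CuspLaws) {l : ℕ} (hodd : Odd l)
    {x : M.Pt} (hx : M.IsCusp x) :
    ((e.piCDataOf ιC hιC).Dx x ⊓ (e.piCDataOf ιC hιC).augGK.ker) ⊔ (e.piCDataOf ιC hιC).barKer l =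
      (e.piCDataOf ιC hιC).barTheta l :=
  (e.piCDataOf ιC hιC).inertia_sup_barKer_of_cuspLaws l hodd.pos op hL hx

/-- The binder `hIx` of `coverDataAx` for THE input bundle `e.piCData` (`Π_C :=` the profinite completion
`e.toPiCHat`), from the cusp laws. [cite: MochizukiEtTh2009, Def 2.1 p.35] -/
theorem piCData_hIx_of_cuspLaws (e : M.CLevelData) (op : M.toThetaSetting.OncePuncturedData)
    (hL : M.toThetaSetting.CuspLaws) {l : ℕ} (hodd : Odd l) {x : M.Pt} (hx : M.IsCusp x) :
    (e.piCData.Dx x ⊓ e.piCData.augGK.ker) ⊔ e.piCData.barKer l = e.piCData.barTheta l :=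
  e.piCData.inertia_sup_barKer_of_cuspLaws l hodd.pos op hL hx

/-! ### `TemperedCoverData` at the model from the cusp laws -/

/-- **`TemperedCoverData` at the model from the cusp laws** (over any injective profinite completion `ιC`
of `Π^tp_C`): abc-iut-L2-d3's `exists_temperedCoverData_of_section` fed with the section of `CuspLaws` (C9)
and `hIx` from (C3); remaining inputs: the bundle `op`, `hιell` (P-C4) and L02 `KerToZIsCompactlyGenerated`.
[cite: MochizukiEtTh2009, Def 2.3 p.38] -/
theorem exists_temperedCoverData_of_cuspLaws (e : M.CLevelData) (ιC : M.GtpC →ₜ* PC)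
    (hιC : IsProfiniteCompletion ιC) (hinj : Function.Injective ιC)
    (op : M.toThetaSetting.OncePuncturedData) (hL : M.toThetaSetting.CuspLaws) {l : ℕ} (hodd : Odd l)
    {x : M.Pt} (hx : M.IsCusp x)
    (hιell : ∀ c ∈ (e.piCDataOf ιC hιC).augGK.ker, c ∉ (e.piCDataOf ιC hιC).PiX →
      ∀ d ∈ (e.piCDataOf ιC hιC).PiX ⊓ (e.piCDataOf ιC hιC).augGK.ker,
        c * d * c⁻¹ * d ∈ (e.piCDataOf ιC hιC).barTheta l)
    (h02 : Thm16Sub.KerToZIsCompactlyGenerated M.toThetaSetting) :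
    ∃ T : TemperedCoverData.{0} l,
      T.toCoverDataAx = (e.piCDataOf ιC hιC).coverDataAx l op hx hodd
        (e.piCDataOf_hIx_of_cuspLaws ιC hιC op hL hodd hx) hιell
        ((e.piCDataOf ιC hιC).inv_theta_of_inv_ell l op hιell) := by
  obtain ⟨s, hs, hsa, hsc⟩ := hL.exists_section hx
  exact e.exists_temperedCoverData_of_section ιC hιC hinj op hodd hx _ hιell h02 s hs hsa hsc

/-- **`ThetaCovers.TemperedCoverData l` is INHABITED over the §1 model from the cusp laws** (`Π_C :=` THE
profinite completion of `Π^tp_C`), given the bundle `op`, `CuspLaws`, `hιell` (P-C4) and L02.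
[cite: MochizukiEtTh2009, Def 2.3 p.38] -/
theorem nonempty_temperedCoverData_of_cuspLaws (e : M.CLevelData)
    (op : M.toThetaSetting.OncePuncturedData) (hL : M.toThetaSetting.CuspLaws) {l : ℕ} (hodd : Odd l)
    {x : M.Pt} (hx : M.IsCusp x)
    (hιell : ∀ c ∈ e.piCData.augGK.ker, c ∉ e.piCData.PiX →
      ∀ d ∈ e.piCData.PiX ⊓ e.piCData.augGK.ker, c * d * c⁻¹ * d ∈ e.piCData.barTheta l)
    (h02 : Thm16Sub.KerToZIsCompactlyGenerated M.toThetaSetting) : Nonempty (TemperedCoverData.{0} l) := by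
  obtain ⟨s, hs, hsa, hsc⟩ := hL.exists_section hx
  exact e.nonempty_temperedCoverData_of_section op hodd hx (e.piCData_hIx_of_cuspLaws op hL hodd hx) hιell
    h02 s hs hsa hsc

/-! ### Cor. 2.9 at the model from the cusp laws -/

section Binders

variable (e : M.CLevelData) (ιC : M.GtpC →ₜ* PC)
    (hιC : IsProfiniteCompletion ιC) (hinj : Function.Injective ιC) (op : M.toThetaSetting.OncePuncturedData)
    {l : ℕ} (hodd : Odd l) {x : M.Pt} (hx : M.IsCusp x)
    (hIx : ((e.piCDataOf ιC hιC).Dx x ⊓ (e.piCDataOf ιC hιC).augGK.ker) ⊔ (e.piCDataOf ιC hιC).barKer l =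
      (e.piCDataOf ιC hιC).barTheta l)
    (hιell : ∀ c ∈ (e.piCDataOf ιC hιC).augGK.ker, c ∉ (e.piCDataOf ιC hιC).PiX →
      ∀ d ∈ (e.piCDataOf ιC hιC).PiX ⊓ (e.piCDataOf ιC hιC).augGK.ker,
        c * d * c⁻¹ * d ∈ (e.piCDataOf ιC hιC).barTheta l)
    (hN : ((M.GtpXu l).map M.inclX).Normal) (hY : (M.GtpY.map M.inclX).Normal) {S : Subgroup PC}
    (hS : ((e.piCDataOf ιC hιC).coverDataAx l op hx hodd hIx hιell
        ((e.piCDataOf ιC hιC).inv_theta_of_inv_ell l op hιell)).toCoverData.IsSplitting S)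
    (hSc : IsClosed (S : Set PC))

/-- **`hC2` at the model from the cusp laws**: the cusp stabiliser of the assembled cover is not inside
`Π^tp_X` — «unique cusp» from `CuspLaws` (C16), compact `D_x` from the bundle, [SemiAnbd] Thm. 6.5 (iii)
(F-1674) BY NAME. [cite: MochizukiEtTh2009, Def 2.1 p.36] -/
theorem temperedCoverData_hC2_of_cuspLaws (hL : M.toThetaSetting.CuspLaws)
    (h65iii : M.toTemperedCurve.IsoPreservesCuspidalDecomp M.toTemperedCurve) :
    ¬ (e.temperedCoverData ιC hιC hinj op hodd hx hIx hιell hN hY hS hSc).cuspStabC ≤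
      (e.temperedCoverData ιC hιC hinj op hodd hx hIx hιell hN hY hS hSc).tp
        (e.temperedCoverData ιC hιC hinj op hodd hx hIx hιell hN hY hS hSc).PiX :=
  temperedCoverData_hC2 e ιC hιC hinj op hodd hx hIx hιell hN hY hS hSc (op.isCompact_decomp x)
    (fun x' hx' => hL.cusp_unique x x' hx hx') h65iii

/-- **[EtTh] Cor. 2.9 (all six members `Ẋ̲̲, Ċ̲, Ċ̲̲, X̲̲, C̲, C̲̲`) at the §1 model from the cusp laws**:
residual = {slimness of `Π^tp_C` ([SemiAnbd] §3), Prop. 2.6 (F-0610), [SemiAnbd] Thm. 6.5 (ii) (F-1658) and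
(iii) (F-1674)} BY NAME + `CuspLaws`; `μ_l ⊆ K` (`HasMuL`) sits inside the typed statement.  «Unique cusp» and
compact `D_x` are no longer binders. [cite: MochizukiEtTh2009, Cor 2.9 p.43] -/
theorem temperedCoverData_cor29_card_of_cuspLaws (hL : M.toThetaSetting.CuspLaws) (hslim : IsSlimGroup M.GtpC)
    (h26 : (e.temperedCoverData ιC hιC hinj op hodd hx hIx hιell hN hY hS hSc).Prop26)
    (h65 : M.toTemperedCurve.DecompCommensurablyTerminal)
    (h65iii : M.toTemperedCurve.IsoPreservesCuspidalDecomp M.toTemperedCurve) :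
    (e.temperedCoverData ιC hιC hinj op hodd hx hIx hιell hN hY hS hSc).Cor29_card :=
  temperedCoverData_cor29_card' e ιC hιC hinj op hodd hx hIx hιell hN hY hS hSc hslim h26
    (op.isCompact_decomp x) h65 (fun x' hx' => hL.cusp_unique x x' hx hx') h65iii

end Binders

/-- **Cor. 2.9 for SOME assembled cover, end to end from the cusp laws**: given the bundle `op`, `CuspLaws`,
`hιell` (P-C4) and L02, there is a `TemperedCoverData l` realising the model's cover-data axioms whose Cor. 2.9
count holds modulo {slimness of `Π^tp_C`, its Prop. 2.6, [SemiAnbd] Thm. 6.5 (ii)/(iii)} — the splitting `S`,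
its closedness and the normalities `hN`/`hY` are PRODUCED (section of C9; L02), not assumed.
[cite: MochizukiEtTh2009, Cor 2.9 p.43] -/
theorem exists_temperedCoverData_cor29_card_of_cuspLaws (e : M.CLevelData) (ιC : M.GtpC →ₜ* PC)
    (hιC : IsProfiniteCompletion ιC) (hinj : Function.Injective ιC)
    (op : M.toThetaSetting.OncePuncturedData) (hL : M.toThetaSetting.CuspLaws) {l : ℕ} (hodd : Odd l)
    {x : M.Pt} (hx : M.IsCusp x)
    (hιell : ∀ c ∈ (e.piCDataOf ιC hιC).augGK.ker, c ∉ (e.piCDataOf ιC hιC).PiX →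
      ∀ d ∈ (e.piCDataOf ιC hιC).PiX ⊓ (e.piCDataOf ιC hιC).augGK.ker,
        c * d * c⁻¹ * d ∈ (e.piCDataOf ιC hιC).barTheta l)
    (h02 : Thm16Sub.KerToZIsCompactlyGenerated M.toThetaSetting) (hslim : IsSlimGroup M.GtpC)
    (h65 : M.toTemperedCurve.DecompCommensurablyTerminal)
    (h65iii : M.toTemperedCurve.IsoPreservesCuspidalDecomp M.toTemperedCurve) :
    ∃ T : TemperedCoverData.{0} l,
      T.toCoverDataAx = (e.piCDataOf ιC hιC).coverDataAx l op hx hodd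
        (e.piCDataOf_hIx_of_cuspLaws ιC hιC op hL hodd hx) hιell
        ((e.piCDataOf ιC hιC).inv_theta_of_inv_ell l op hιell) ∧ (T.Prop26 → T.Cor29_card) := by
  obtain ⟨s, hs, hsa, hsc⟩ := hL.exists_section hx
  refine ⟨e.temperedCoverData ιC hιC hinj op hodd hx (e.piCDataOf_hIx_of_cuspLaws ιC hιC op hL hodd hx) hιell
      (e.map_inclX_GtpXu_normal l h02) (e.map_inclX_GtpY_normal h02)
      ((e.piCDataOf ιC hιC).isSplitting_of_section l op hx hodd _ hιell _ s hs hsa)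
      ((e.piCDataOf ιC hιC).isClosed_splittingOfSection l op s hsc),
    e.temperedCoverData_toCoverDataAx ιC hιC hinj op hodd hx _ hιell _ _ _ _, fun h26 => ?_⟩
  exact temperedCoverData_cor29_card_of_cuspLaws e ιC hιC hinj op hodd hx _ hιell _ _ _ _ hL hslim h26 h65
    h65iii

/-! ### The END KNIT's print-shaped Cor. 2.9 from the cusp laws -/

section BindersPNat

variable (e : M.CLevelData) (ιC : M.GtpC →ₜ* PC)
    (hιC : IsProfiniteCompletion ιC) (hinj : Function.Injective ιC) (op : M.toThetaSetting.OncePuncturedData)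
    {l : ℕ+} (hodd : Odd (l : ℕ)) {x : M.Pt} (hx : M.IsCusp x)
    (hIx : ((e.piCDataOf ιC hιC).Dx x ⊓ (e.piCDataOf ιC hιC).augGK.ker) ⊔ (e.piCDataOf ιC hιC).barKer l =
      (e.piCDataOf ιC hιC).barTheta l)
    (hιell : ∀ c ∈ (e.piCDataOf ιC hιC).augGK.ker, c ∉ (e.piCDataOf ιC hιC).PiX →
      ∀ d ∈ (e.piCDataOf ιC hιC).PiX ⊓ (e.piCDataOf ιC hιC).augGK.ker,
        c * d * c⁻¹ * d ∈ (e.piCDataOf ιC hιC).barTheta l)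
    (hN : ((M.GtpXu l).map M.inclX).Normal) (hY : (M.GtpY.map M.inclX).Normal) {S : Subgroup PC}
    (hS : ((e.piCDataOf ιC hιC).coverDataAx l op hx hodd hIx hιell
        ((e.piCDataOf ιC hιC).inv_theta_of_inv_ell l op hιell)).toCoverData.IsSplitting S)
    (hSc : IsClosed (S : Set PC))

/-- **[EtTh] Cor. 2.9 AT THE §1 MODEL, print-shaped, origin clause from the cusp laws**: abc-iut-L2-d3's END KNIT
`temperedCoverData_natCard_cuspOrbits` with «unique cusp» := `CuspLaws.cusp_unique` — if `K ⊇ μ_l` then each of the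
six members has `(l+1)/2` `Aut_K(−)`-orbits of cusps, modulo named facts {slimness of `Π^tp_X`, Prop. 2.6, F-1658,
F-1674}, the cyclotome datum and `T`'s own binders. [cite: MochizukiEtTh2009, Cor 2.9 p.43] -/
theorem temperedCoverData_natCard_cuspOrbits_of_cuspLaws (hL : M.toThetaSetting.CuspLaws) (hl : (l : ℕ) ≠ 1)
    (hX : IsSlimGroup M.PiTemp) (h26 : (e.temperedCoverData ιC hιC hinj op hodd hx hIx hιell hN hY hS hSc).Prop26)
    (h65 : M.toTemperedCurve.DecompCommensurablyTerminal)
    (h65iii : M.toTemperedCurve.IsoPreservesCuspidalDecomp M.toTemperedCurve)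
    (μ : M.toThetaSetting.CyclotomeMod 1 l) (hμK : ∀ ζ : MuN p l, (((ζ : (PadicAlgCl p)ˣ) : PadicAlgCl p)) ∈ M.K) :
    ∀ S' ∈ [(e.temperedCoverData ιC hιC hinj op hodd hx hIx hιell hN hY hS hSc).tp
          (e.temperedCoverData ιC hιC hinj op hodd hx hIx hιell hN hY hS hSc).PiXuu ⊓
          (e.temperedCoverData ιC hιC hinj op hodd hx hIx hιell hN hY hS hSc).PiCdot,
        (e.temperedCoverData ιC hιC hinj op hodd hx hIx hιell hN hY hS hSc).tp
          (e.temperedCoverData ιC hιC hinj op hodd hx hIx hιell hN hY hS hSc).PiCu ⊓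
          (e.temperedCoverData ιC hιC hinj op hodd hx hIx hιell hN hY hS hSc).PiCdot,
        (e.temperedCoverData ιC hιC hinj op hodd hx hIx hιell hN hY hS hSc).tp
          (e.temperedCoverData ιC hιC hinj op hodd hx hIx hιell hN hY hS hSc).PiCuu ⊓
          (e.temperedCoverData ιC hιC hinj op hodd hx hIx hιell hN hY hS hSc).PiCdot,
        (e.temperedCoverData ιC hιC hinj op hodd hx hIx hιell hN hY hS hSc).tp
          (e.temperedCoverData ιC hιC hinj op hodd hx hIx hιell hN hY hS hSc).PiXuu,
        (e.temperedCoverData ιC hιC hinj op hodd hx hIx hιell hN hY hS hSc).tp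
          (e.temperedCoverData ιC hιC hinj op hodd hx hIx hιell hN hY hS hSc).PiCu,
        (e.temperedCoverData ιC hιC hinj op hodd hx hIx hιell hN hY hS hSc).tp
          (e.temperedCoverData ιC hιC hinj op hodd hx hIx hιell hN hY hS hSc).PiCuu],
      Nat.card ((e.temperedCoverData ιC hιC hinj op hodd hx hIx hιell hN hY hS hSc).cuspOrbits S') =
        ((l : ℕ) + 1) / 2 :=
  temperedCoverData_natCard_cuspOrbits e ιC hιC hinj op hodd hx hIx hιell hN hY hS hSc hl hX h26 h65 h65iii
    (fun x' hx' => hL.cusp_unique x x' hx hx') μ hμK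

end BindersPNat

/-- **[EtTh] Cor. 2.9 AT THE §1 MODEL, END TO END from the cusp laws**: from the bundle `op`, `CuspLaws`, `hιell`
(P-C4) and L02 a cover `T : TemperedCoverData l` realising the model's cover-data axioms is PRODUCED (its splitting
from the section of C9, closed by compactness of `G_K`; its normalities from L02) such that, if `K ⊇ μ_l`, each of
the six members has `(l+1)/2` `Aut_K(−)`-orbits of cusps — modulo the named facts {slimness of `Π^tp_X` ([SemiAnbd]
§3), `T.Prop26` ([EtTh] Prop. 2.6, F-0610), [SemiAnbd] Thm. 6.5 (ii)/(iii) (F-1658/F-1674)}, the cyclotome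
identification datum `CyclotomeMod 1 l`, `l` odd `≠ 1`.  NO cusp binder remains (no `hIx`, no section, no «unique
cusp», no compact `D_x`). [cite: MochizukiEtTh2009, Cor 2.9 p.43] -/
theorem exists_temperedCoverData_natCard_cuspOrbits_of_cuspLaws (e : M.CLevelData) (ιC : M.GtpC →ₜ* PC)
    (hιC : IsProfiniteCompletion ιC) (hinj : Function.Injective ιC)
    (op : M.toThetaSetting.OncePuncturedData) (hL : M.toThetaSetting.CuspLaws) {l : ℕ+} (hodd : Odd (l : ℕ))
    (hl : (l : ℕ) ≠ 1) {x : M.Pt} (hx : M.IsCusp x)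
    (hιell : ∀ c ∈ (e.piCDataOf ιC hιC).augGK.ker, c ∉ (e.piCDataOf ιC hιC).PiX →
      ∀ d ∈ (e.piCDataOf ιC hιC).PiX ⊓ (e.piCDataOf ιC hιC).augGK.ker,
        c * d * c⁻¹ * d ∈ (e.piCDataOf ιC hιC).barTheta l)
    (h02 : Thm16Sub.KerToZIsCompactlyGenerated M.toThetaSetting) (hX : IsSlimGroup M.PiTemp)
    (h65 : M.toTemperedCurve.DecompCommensurablyTerminal)
    (h65iii : M.toTemperedCurve.IsoPreservesCuspidalDecomp M.toTemperedCurve)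
    (μ : M.toThetaSetting.CyclotomeMod 1 l) (hμK : ∀ ζ : MuN p l, (((ζ : (PadicAlgCl p)ˣ) : PadicAlgCl p)) ∈ M.K) :
    ∃ T : TemperedCoverData.{0} l,
      T.toCoverDataAx = (e.piCDataOf ιC hιC).coverDataAx l op hx hodd
        (e.piCDataOf_hIx_of_cuspLaws ιC hιC op hL hodd hx) hιell
        ((e.piCDataOf ιC hιC).inv_theta_of_inv_ell l op hιell) ∧
      (T.Prop26 → ∀ S' ∈ [T.tp T.PiXuu ⊓ T.PiCdot, T.tp T.PiCu ⊓ T.PiCdot, T.tp T.PiCuu ⊓ T.PiCdot,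
          T.tp T.PiXuu, T.tp T.PiCu, T.tp T.PiCuu], Nat.card (T.cuspOrbits S') = ((l : ℕ) + 1) / 2) := by
  obtain ⟨s, hs, hsa, hsc⟩ := hL.exists_section hx
  refine ⟨e.temperedCoverData ιC hιC hinj op hodd hx (e.piCDataOf_hIx_of_cuspLaws ιC hιC op hL hodd hx) hιell
      (e.map_inclX_GtpXu_normal l h02) (e.map_inclX_GtpY_normal h02)
      ((e.piCDataOf ιC hιC).isSplitting_of_section l op hx hodd _ hιell _ s hs hsa)
      ((e.piCDataOf ιC hιC).isClosed_splittingOfSection l op s hsc),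
    e.temperedCoverData_toCoverDataAx ιC hιC hinj op hodd hx _ hιell _ _ _ _, fun h26 => ?_⟩
  exact temperedCoverData_natCard_cuspOrbits_of_cuspLaws e ιC hιC hinj op hodd hx _ hιell _ _ _ _ hL hl hX h26
    h65 h65iii μ hμK

end MuTwoSetting.CLevelData

end Literature.AnabelianGeometry.EtaleTheta
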